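import Mathlib
import Summits.NavierStokesRegularity.NavierStokesRegularity.Theorems.EulerZoomLiouvillePowerGaugeEulerLiouvilleNeedleCauchyLocal
import Summits.NavierStokesRegularity.NavierStokesRegularity.Theorems.EulerZoomLiouvillePowerGaugeEulerLiouvilleSelfSimilarKelvinFlowC2

/-!
# THE STRETCHING CRITERION (variable rate) along lingering backward cut-off orbits (plate t40h, nsreg-p2 g33's spec)

Width piece for crux `EulerZoomLiouville.PowerGaugeEulerLiouville` (stmt-NavierStokesRegularity-19832), by name under
LEAD 19832 (ns-typeII-p2 g12); seat ns-in-ser-c g3 (director-ns inputs-36), `--supports stmt-NavierStokesRegularity-19832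
--as helper`.  Setting of t40a (`…NeedleCauchyLocal`): `(U, P)` a `C²` self-similar Euler profile, `V ∈ C¹` a cut-off copy
(`‖DV‖ ≤ K`, `V = U` on `ball 0 R_big`), `Ψ_σ y := Φ^V_{−σ} y` the backward cut-off similarity flow, `M < R_big`, and a
label `y` whose orbit LINGERS: `‖Ψ_σ y‖ ≤ M` for `σ ∈ [0, L]`.  New input: a CONTINUOUS STRETCHING MAJORANT `s` on `B̄_M`,
`⟪DU(z)v, v⟫ ≤ s(z)‖v‖²`.

* (T1) `norm_curl_sq_mul_exp_le_linger` — `‖Ω(y)‖² · exp(2∫₀^σ (1 − s(Ψ_τ y)) dτ) ≤ ‖Ω(Ψ_σ y)‖²` for `σ ∈ [0, L]`: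
  `φ(r) := ‖Ω(Ψ_r y)‖²` has `φ′ = 2⟪Ω − DU·Ω, Ω⟫ ≥ 2(1 − s(Ψ_r y))φ` by the vorticity profile equation along the orbit
  (t40a `hasDerivAt_curl_flow_neg` — NO Cauchy formula, NO Liouville), so `exp(−2∫₀^r(1 − s∘Ψ))·φ` is monotone on `[0, L]`
  (`hasDerivAt_norm_curl_flow_sq`, `monotoneOn_weightedVorticity_linger`);
* (T2) `integral_one_sub_stretching_le_log_linger` — with `‖Ω‖ ≤ O` on `B̄_M` and `Ω(y) ≠ 0`:
  `∫₀^σ (1 − s(Ψ_τ y)) dτ ≤ log(O/‖Ω(y)‖)`;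
* (T3) `sub_log_le_integral_stretching_linger` — `σ − log(O/‖Ω(y)‖) ≤ ∫₀^σ s(Ψ_τ y) dτ`.

MEANING (ROUND-40 §1 (S′), the sharp form of the strain clocks): along EVERY lingering vortical orbit the TIME-AVERAGED
MAXIMAL STRETCHING is `≥ 1 − log(O/ω)/σ → 1` — the finite-time, variable-rate, cut-off-local form of LEAD's
`curl_eq_zero_of_backward_orbit_stretching_lt`; its constant-rate case `s ≡ const` is t40d (S3)
(`NeedleClock.norm_curl_mul_exp_le_of_stretching_linger`, `…NeedleStrainClock`, ezl-w5 g3, p647507 — not restated here) and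
it implies the compression criterion
(C2) of t40f (`κ ≥ λ_max/2` when `tr sym DU = 0`).  Non-vortical degenerate nodes `DU = diag(2γ, −γ, −γ)` (`s = 2γ < 1`)
cannot host long hovering; the long-time hosts are pieces of `𝒩 = {W = 0}` with `λ_max(sym DU) ≥ 1`.

HONEST FRAMING: statements about the flow of HYPOTHETICAL self-similar Euler profiles (blow-up needles); nothing here proves
the crux E `PowerGaugeEulerLiouville` (19832 OPEN), any door Target, or any Navier–Stokes regularity statement; no summit
statement is touched. [cite: ConstantinIgnatovaVicol2026Putative, §3.1.1 eq. (3.4); folklore (Grönwall)]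
-/

noncomputable section

open Set Filter Topology Metric Function MeasureTheory intervalIntegral
open scoped RealInnerProductSpace NNReal ENNReal

set_option linter.dupNamespace false

namespace Summit.NavierStokesRegularity.NavierStokesRegularity.Theorems.PowerGaugeEulerLiouville.NeedleClock

open Literature.Analysis Literature.Analysis.FluidPDE
open Summit.NavierStokesRegularity.NavierStokesRegularity.Theorems.PowerGaugeEulerLiouville

variable {γ : ℝ} {U V : EuclideanSpace ℝ (Fin 3) → EuclideanSpace ℝ (Fin 3)} {P : EuclideanSpace ℝ (Fin 3) → ℝ}

/-- Backward cut-off orbits `r ↦ Ψ_r y` are continuous. [folklore] -/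
theorem continuous_flow_neg_apply (hV : ContDiff ℝ 1 V) {K : ℝ} (hK : ∀ y, ‖fderiv ℝ V y‖ ≤ K)
    (y : EuclideanSpace ℝ (Fin 3)) :
    Continuous fun r : ℝ => ODE.evolutionMap (fun _ : ℝ => selfSimilarTransport γ 0 V) 0 (-r) y :=
  (C2.Kelvin.continuous_flow_apply (γ := γ) hV hK y).comp continuous_neg

/-- **The enstrophy of a label along a backward cut-off orbit**: while `Ψ_σ y ∈ ball 0 R_big`,
`d/dσ ‖Ω(Ψ_σ y)‖² = 2 (‖Ω(Ψ_σ y)‖² − ⟪Ω(Ψ_σ y), DU(Ψ_σ y) Ω(Ψ_σ y)⟫)`. [cite: ConstantinIgnatovaVicol2026Putative, §3.1.1 eq. (3.4)] -/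
theorem hasDerivAt_norm_curl_flow_sq (hprof : IsSelfSimilarEulerProfile γ 0 U P) (hV : ContDiff ℝ 1 V) {K : ℝ}
    (hK : ∀ y, ‖fderiv ℝ V y‖ ≤ K) {Rbig : ℝ}
    (hVU : ∀ w ∈ ball (0 : EuclideanSpace ℝ (Fin 3)) Rbig, V w = U w) (y : EuclideanSpace ℝ (Fin 3)) {σ : ℝ}
    (hz : ODE.evolutionMap (fun _ : ℝ => selfSimilarTransport γ 0 V) 0 (-σ) y ∈
      ball (0 : EuclideanSpace ℝ (Fin 3)) Rbig) :
    HasDerivAt (fun r => ‖curl U (ODE.evolutionMap (fun _ : ℝ => selfSimilarTransport γ 0 V) 0 (-r) y)‖ ^ 2)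
      (2 * (‖curl U (ODE.evolutionMap (fun _ : ℝ => selfSimilarTransport γ 0 V) 0 (-σ) y)‖ ^ 2 -
        ⟪curl U (ODE.evolutionMap (fun _ : ℝ => selfSimilarTransport γ 0 V) 0 (-σ) y),
          fderiv ℝ U (ODE.evolutionMap (fun _ : ℝ => selfSimilarTransport γ 0 V) 0 (-σ) y)
            (curl U (ODE.evolutionMap (fun _ : ℝ => selfSimilarTransport γ 0 V) 0 (-σ) y))⟫)) σ := by
  have h := (hasDerivAt_curl_flow_neg hprof hV hK hVU y hz).norm_sq
  refine h.congr_deriv ?_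
  rw [inner_sub_right, real_inner_self_eq_norm_sq]

/-- **The weighted enstrophy is monotone along a lingering orbit.**  With a continuous stretching majorant `s` on `B̄_M`
(`⟪DU(z)v, v⟫ ≤ s(z)‖v‖²`), the function `r ↦ exp(−2∫₀^r (1 − s(Ψ_τ y)) dτ) · ‖Ω(Ψ_r y)‖²` is monotone on `[0, L]`.
[folklore] -/
theorem monotoneOn_weightedVorticity_linger (hprof : IsSelfSimilarEulerProfile γ 0 U P) (hV : ContDiff ℝ 1 V) {K : ℝ}
    (hK : ∀ y, ‖fderiv ℝ V y‖ ≤ K) {M Rbig : ℝ} (hMR : M < Rbig)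
    (hVU : ∀ w ∈ ball (0 : EuclideanSpace ℝ (Fin 3)) Rbig, V w = U w)
    {s : EuclideanSpace ℝ (Fin 3) → ℝ} (hsc : Continuous s)
    (hs : ∀ z ∈ closedBall (0 : EuclideanSpace ℝ (Fin 3)) M, ∀ v, ⟪fderiv ℝ U z v, v⟫ ≤ s z * ‖v‖ ^ 2)
    {y : EuclideanSpace ℝ (Fin 3)} {L : ℝ}
    (hy : ∀ σ ∈ Icc (0 : ℝ) L, ‖ODE.evolutionMap (fun _ : ℝ => selfSimilarTransport γ 0 V) 0 (-σ) y‖ ≤ M) :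
    MonotoneOn (fun r => Real.exp (-(2 * ∫ τ in (0:ℝ)..r,
        (1 - s (ODE.evolutionMap (fun _ : ℝ => selfSimilarTransport γ 0 V) 0 (-τ) y)))) *
      ‖curl U (ODE.evolutionMap (fun _ : ℝ => selfSimilarTransport γ 0 V) 0 (-r) y)‖ ^ 2) (Icc (0 : ℝ) L) := by
  set Ψ : ℝ → EuclideanSpace ℝ (Fin 3) := fun r => ODE.evolutionMap (fun _ : ℝ => selfSimilarTransport γ 0 V) 0 (-r) y
    with hΨ
  have hΨc : Continuous Ψ := continuous_flow_neg_apply (γ := γ) hV hK y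
  -- the integrand `1 − s ∘ Ψ` and its primitive
  set a : ℝ → ℝ := fun τ => 1 - s (Ψ τ) with ha
  have hac : Continuous a := continuous_const.sub (hsc.comp hΨc)
  set g : ℝ → ℝ := fun r => ∫ τ in (0:ℝ)..r, a τ with hg
  have hg' : ∀ r, HasDerivAt g (a r) r := fun r => (hac.integral_hasStrictDerivAt 0 r).hasDerivAt
  -- the enstrophy along the orbit
  set φ : ℝ → ℝ := fun r => ‖curl U (Ψ r)‖ ^ 2 with hφ
  have hball : ∀ r ∈ Icc (0 : ℝ) L, Ψ r ∈ ball (0 : EuclideanSpace ℝ (Fin 3)) Rbig := fun r hr =>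
    mem_ball_zero_iff.2 (lt_of_le_of_lt (hy r hr) hMR)
  have hφ' : ∀ r ∈ Icc (0 : ℝ) L, HasDerivAt φ (2 * (‖curl U (Ψ r)‖ ^ 2 -
      ⟪curl U (Ψ r), fderiv ℝ U (Ψ r) (curl U (Ψ r))⟫)) r := fun r hr =>
    hasDerivAt_norm_curl_flow_sq hprof hV hK hVU y (hball r hr)
  -- the weighted enstrophy `F = exp(−2g) · φ`
  set F : ℝ → ℝ := fun r => Real.exp (-(2 * g r)) * φ r with hF
  have hF' : ∀ r ∈ Icc (0 : ℝ) L, HasDerivAt F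
      (Real.exp (-(2 * g r)) * (-(2 * a r)) * φ r +
        Real.exp (-(2 * g r)) * (2 * (‖curl U (Ψ r)‖ ^ 2 - ⟪curl U (Ψ r), fderiv ℝ U (Ψ r) (curl U (Ψ r))⟫))) r := by
    intro r hr
    have h1 : HasDerivAt (fun r => Real.exp (-(2 * g r))) (Real.exp (-(2 * g r)) * (-(2 * a r))) r :=
      (((hg' r).const_mul 2).neg).exp
    exact h1.mul (hφ' r hr)
  -- its derivative is nonnegative by the stretching majorant
  have hF'nn : ∀ r ∈ Icc (0 : ℝ) L, 0 ≤ Real.exp (-(2 * g r)) * (-(2 * a r)) * φ r +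
      Real.exp (-(2 * g r)) * (2 * (‖curl U (Ψ r)‖ ^ 2 - ⟪curl U (Ψ r), fderiv ℝ U (Ψ r) (curl U (Ψ r))⟫)) := by
    intro r hr
    have hsr := hs (Ψ r) (mem_closedBall_zero_iff.2 (hy r hr)) (curl U (Ψ r))
    rw [real_inner_comm] at hsr
    have he : 0 < Real.exp (-(2 * g r)) := Real.exp_pos _
    have hcalc : Real.exp (-(2 * g r)) * (-(2 * a r)) * φ r +
        Real.exp (-(2 * g r)) * (2 * (‖curl U (Ψ r)‖ ^ 2 - ⟪curl U (Ψ r), fderiv ℝ U (Ψ r) (curl U (Ψ r))⟫)) =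
        Real.exp (-(2 * g r)) * (2 * (s (Ψ r) * ‖curl U (Ψ r)‖ ^ 2 -
          ⟪curl U (Ψ r), fderiv ℝ U (Ψ r) (curl U (Ψ r))⟫)) := by
      simp only [ha, hφ]; ring
    rw [hcalc]
    exact mul_nonneg he.le (by linarith)
  -- monotone on `[0, L]`
  have hFc : ContinuousOn F (Icc (0 : ℝ) L) := fun r hr => (hF' r hr).continuousAt.continuousWithinAt
  have hmono := monotoneOn_of_hasDerivWithinAt_nonneg (convex_Icc (0 : ℝ) L) hFc
    (fun r hr => (hF' r (interior_subset hr)).hasDerivWithinAt) (fun r hr => hF'nn r (interior_subset hr))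
  simpa [hF, hg, ha, hφ, hΨ] using hmono

/-- **(T1) THE STRETCHING INEQUALITY along a lingering orbit.**  For every `σ ∈ [0, L]`:
`‖Ω(y)‖² · exp(2∫₀^σ (1 − s(Ψ_τ y)) dτ) ≤ ‖Ω(Ψ_σ y)‖²`. [folklore] -/
theorem norm_curl_sq_mul_exp_le_linger (hprof : IsSelfSimilarEulerProfile γ 0 U P) (hV : ContDiff ℝ 1 V) {K : ℝ}
    (hK : ∀ y, ‖fderiv ℝ V y‖ ≤ K) {M Rbig : ℝ} (hMR : M < Rbig)
    (hVU : ∀ w ∈ ball (0 : EuclideanSpace ℝ (Fin 3)) Rbig, V w = U w)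
    {s : EuclideanSpace ℝ (Fin 3) → ℝ} (hsc : Continuous s)
    (hs : ∀ z ∈ closedBall (0 : EuclideanSpace ℝ (Fin 3)) M, ∀ v, ⟪fderiv ℝ U z v, v⟫ ≤ s z * ‖v‖ ^ 2)
    {y : EuclideanSpace ℝ (Fin 3)} {L : ℝ}
    (hy : ∀ σ ∈ Icc (0 : ℝ) L, ‖ODE.evolutionMap (fun _ : ℝ => selfSimilarTransport γ 0 V) 0 (-σ) y‖ ≤ M) :
    ∀ σ ∈ Icc (0 : ℝ) L,
      ‖curl U y‖ ^ 2 * Real.exp (2 * ∫ τ in (0:ℝ)..σ,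
          (1 - s (ODE.evolutionMap (fun _ : ℝ => selfSimilarTransport γ 0 V) 0 (-τ) y))) ≤
        ‖curl U (ODE.evolutionMap (fun _ : ℝ => selfSimilarTransport γ 0 V) 0 (-σ) y)‖ ^ 2 := by
  intro σ hσ
  have hmono := monotoneOn_weightedVorticity_linger hprof hV hK hMR hVU hsc hs hy
  have h0 : (0 : ℝ) ∈ Icc (0 : ℝ) L := ⟨le_rfl, hσ.1.trans hσ.2⟩
  have h := hmono h0 hσ hσ.1
  simp only [intervalIntegral.integral_same, mul_zero, neg_zero, Real.exp_zero, one_mul, neg_zero,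
    ODE.evolutionMap_self] at h
  -- `h : ‖Ω y‖² ≤ exp(−2I) · ‖Ω(Ψ_σ y)‖²`
  set I := ∫ τ in (0:ℝ)..σ, (1 - s (ODE.evolutionMap (fun _ : ℝ => selfSimilarTransport γ 0 V) 0 (-τ) y)) with hI
  have hexp : Real.exp (2 * I) * Real.exp (-(2 * I)) = 1 := by
    rw [← Real.exp_add, add_neg_cancel, Real.exp_zero]
  calc ‖curl U y‖ ^ 2 * Real.exp (2 * I)
      ≤ (Real.exp (-(2 * I)) * ‖curl U (ODE.evolutionMap (fun _ : ℝ => selfSimilarTransport γ 0 V) 0 (-σ) y)‖ ^ 2) *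
          Real.exp (2 * I) := mul_le_mul_of_nonneg_right h (Real.exp_pos _).le
    _ = ‖curl U (ODE.evolutionMap (fun _ : ℝ => selfSimilarTransport γ 0 V) 0 (-σ) y)‖ ^ 2 := by
          rw [mul_comm (Real.exp _), mul_assoc, mul_comm (Real.exp (-(2 * I))), hexp, mul_one]

/-- **(T2) THE STRETCHING CRITERION, logarithmic form.**  With `‖Ω‖ ≤ O` on `B̄_M` and `Ω(y) ≠ 0`:
`∫₀^σ (1 − s(Ψ_τ y)) dτ ≤ log(O / ‖Ω(y)‖)` for every `σ ∈ [0, L]`. [folklore] -/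
theorem integral_one_sub_stretching_le_log_linger (hprof : IsSelfSimilarEulerProfile γ 0 U P) (hV : ContDiff ℝ 1 V)
    {K : ℝ} (hK : ∀ y, ‖fderiv ℝ V y‖ ≤ K) {M Rbig : ℝ} (hMR : M < Rbig)
    (hVU : ∀ w ∈ ball (0 : EuclideanSpace ℝ (Fin 3)) Rbig, V w = U w)
    {s : EuclideanSpace ℝ (Fin 3) → ℝ} (hsc : Continuous s)
    (hs : ∀ z ∈ closedBall (0 : EuclideanSpace ℝ (Fin 3)) M, ∀ v, ⟪fderiv ℝ U z v, v⟫ ≤ s z * ‖v‖ ^ 2)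
    {O : ℝ} (hO : ∀ z ∈ closedBall (0 : EuclideanSpace ℝ (Fin 3)) M, ‖curl U z‖ ≤ O)
    {y : EuclideanSpace ℝ (Fin 3)} (hΩ : curl U y ≠ 0) {L : ℝ}
    (hy : ∀ σ ∈ Icc (0 : ℝ) L, ‖ODE.evolutionMap (fun _ : ℝ => selfSimilarTransport γ 0 V) 0 (-σ) y‖ ≤ M) :
    ∀ σ ∈ Icc (0 : ℝ) L,
      ∫ τ in (0:ℝ)..σ, (1 - s (ODE.evolutionMap (fun _ : ℝ => selfSimilarTransport γ 0 V) 0 (-τ) y)) ≤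
        Real.log (O / ‖curl U y‖) := by
  intro σ hσ
  set I := ∫ τ in (0:ℝ)..σ, (1 - s (ODE.evolutionMap (fun _ : ℝ => selfSimilarTransport γ 0 V) 0 (-τ) y)) with hI
  have hω : 0 < ‖curl U y‖ := norm_pos_iff.2 hΩ
  have hT1 := norm_curl_sq_mul_exp_le_linger hprof hV hK hMR hVU hsc hs hy σ hσ
  have hOσ := hO _ (mem_closedBall_zero_iff.2 (hy σ hσ))
  have hO0 : 0 ≤ O := (norm_nonneg _).trans hOσ
  -- `‖Ω y‖² e^{2I} ≤ O²`
  have h1 : ‖curl U y‖ ^ 2 * Real.exp (2 * I) ≤ O ^ 2 :=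
    hT1.trans (pow_le_pow_left₀ (norm_nonneg _) hOσ 2)
  have hOpos : 0 < O := by
    have h00 := hO _ (mem_closedBall_zero_iff.2 (hy 0 ⟨le_rfl, hσ.1.trans hσ.2⟩))
    rw [neg_zero, ODE.evolutionMap_self] at h00
    exact hω.trans_le h00
  -- take logarithms
  have h2 : Real.exp (2 * I) ≤ (O / ‖curl U y‖) ^ 2 := by
    rw [div_pow, le_div_iff₀ (by positivity)]
    linarith [h1]
  have h3 : 2 * I ≤ Real.log ((O / ‖curl U y‖) ^ 2) := by
    rw [← Real.log_exp (2 * I)]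
    exact Real.log_le_log (Real.exp_pos _) h2
  rw [Real.log_pow] at h3
  push_cast at h3
  linarith

/-- **(T3) THE STRETCHING CRITERION.**  Along every lingering vortical orbit the time-integrated stretching majorant is
large: `σ − log(O / ‖Ω(y)‖) ≤ ∫₀^σ s(Ψ_τ y) dτ` for every `σ ∈ [0, L]` — the time-AVERAGED maximal stretching is
`≥ 1 − log(O/ω)/σ`. [folklore] -/
theorem sub_log_le_integral_stretching_linger (hprof : IsSelfSimilarEulerProfile γ 0 U P) (hV : ContDiff ℝ 1 V)
    {K : ℝ} (hK : ∀ y, ‖fderiv ℝ V y‖ ≤ K) {M Rbig : ℝ} (hMR : M < Rbig)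
    (hVU : ∀ w ∈ ball (0 : EuclideanSpace ℝ (Fin 3)) Rbig, V w = U w)
    {s : EuclideanSpace ℝ (Fin 3) → ℝ} (hsc : Continuous s)
    (hs : ∀ z ∈ closedBall (0 : EuclideanSpace ℝ (Fin 3)) M, ∀ v, ⟪fderiv ℝ U z v, v⟫ ≤ s z * ‖v‖ ^ 2)
    {O : ℝ} (hO : ∀ z ∈ closedBall (0 : EuclideanSpace ℝ (Fin 3)) M, ‖curl U z‖ ≤ O)
    {y : EuclideanSpace ℝ (Fin 3)} (hΩ : curl U y ≠ 0) {L : ℝ}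
    (hy : ∀ σ ∈ Icc (0 : ℝ) L, ‖ODE.evolutionMap (fun _ : ℝ => selfSimilarTransport γ 0 V) 0 (-σ) y‖ ≤ M) :
    ∀ σ ∈ Icc (0 : ℝ) L,
      σ - Real.log (O / ‖curl U y‖) ≤
        ∫ τ in (0:ℝ)..σ, s (ODE.evolutionMap (fun _ : ℝ => selfSimilarTransport γ 0 V) 0 (-τ) y) := by
  intro σ hσ
  have hT2 := integral_one_sub_stretching_le_log_linger hprof hV hK hMR hVU hsc hs hO hΩ hy σ hσ
  have hΨc : Continuous fun r : ℝ => ODE.evolutionMap (fun _ : ℝ => selfSimilarTransport γ 0 V) 0 (-r) y :=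
    continuous_flow_neg_apply (γ := γ) hV hK y
  have hsi : IntervalIntegrable (fun τ => s (ODE.evolutionMap (fun _ : ℝ => selfSimilarTransport γ 0 V) 0 (-τ) y))
      volume 0 σ := (hsc.comp hΨc).intervalIntegrable _ _
  have hsplit : ∫ τ in (0:ℝ)..σ, (1 - s (ODE.evolutionMap (fun _ : ℝ => selfSimilarTransport γ 0 V) 0 (-τ) y)) =
      σ - ∫ τ in (0:ℝ)..σ, s (ODE.evolutionMap (fun _ : ℝ => selfSimilarTransport γ 0 V) 0 (-τ) y) := by
    rw [intervalIntegral.integral_sub intervalIntegrable_const hsi, intervalIntegral.integral_const]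
    simp
  rw [hsplit] at hT2
  linarith

end Summit.NavierStokesRegularity.NavierStokesRegularity.Theorems.PowerGaugeEulerLiouville.NeedleClock

end
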